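import Summits.AtomisticToContinuum.Crystallization.Theorems.OverbindingBudgetDeepBareExclusion

/-!
# OverbindingBudget — the DEPTH CUT of the declared residual `CleanBearingResidual 10` (depth cut, part 3/3; helper `--supports stmt-31280`)

Route `OverbindingBudget` (Crystallization), crux `RobustDefectLimitWindows` (stmt-AtomisticToContinuum-31280), registered skeleton line v7
«HostedDustCut» (sha 624a0fa0…), whose sixth stub `stub_unhostedResidual` is the declared residual `UnhostedResidual 10`.  Generation 17 (landed
`Theorems/OverbindingBudgetCleanlessCut.lean`) cut it exactly into `CleanlessPiece 10` (VACUOUS given the door law `CleanlessExcess`, proved) and the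
declared residual `CleanBearingResidual 10` (unhosted at radius 10 yet carrying a ROBUSTLY clean Barlow site at some admissible spacing).  This file
(decomp-a2c lens 4 «minimal counterexample / extremal reduction», generation 18, part 3 of 3) lands, complete and over LANDED Theorems files only, the
next NORMAL FORM of the minimal counterexample — «NO DEEP BARE POCKET» — and PROVES that the graded law empties the other side.  Nothing here is
registered on the line (cell critic waiver (w2), CRITIC-LEDGER rows 134 / 213 / 214): the registered residual is DERIVED (K-d5), never re-typed; the
pinned texts (§E here, §P of part 1) are what a later bundle may register (`stub_cleanlessExcessT`, `stub_shallowResidual`) at embargo lift.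

Part 1 `OverbindingBudgetGradedBareness`: `BareOnT` (graded bareness), THE GRADED LAW `CleanlessExcessT` (∀ t₀ ∈ (0,1/100) ∃ κ(t₀) > 0: t₀-bare
sandwiched convex chunks pay `(e+κ)#S − σR²`; implies the landed `CleanlessExcess`, K-g1; law text to register at lift = THIS graded one, critic row
214(a)), the cut literal `ShallowBearing` (margin-uniform Barlow order: ∀ t ∈ (0,1/200) the t-robustly clean Barlow sites are R(t)-dense), transport
K-g4, finite-partner cross bound K-g7.  Part 2 `OverbindingBudgetDeepBareExclusion`: **the depth kernel `shallowBearing_of_graded`** — graded law ∧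
TEND ∧ LB ∧ two-way uniform recurrence ∧ UD ∧ μ-stability ∧ covering radius `< 9/10 ⟹ ShallowBearing Y` (deep bare pocket ⟹ by recurrence k³ disjoint
bare s-cubes in a big cube ⟹ additive charge `≥ (3/4)η₀ℓ³` against the landed `cubeChargeLaw` cap `(η₀/4)ℓ³`; constants fixed non-circularly).

* §A  the two pieces: `DeepPiece r₀` (RDEF-hyps ∧ ¬Hosted r₀ ∧ CleanBearing ∧ ¬ShallowBearing ⟹ windows) and `ShallowResidual r₀` (RDEF-hyps ∧
  ¬Hosted r₀ ∧ CleanBearing ∧ ShallowBearing ⟹ windows).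
* §D  **K-d1 `cleanBearingResidual_iff_pieces`** (the cut is exact: excluded middle on `ShallowBearing Y`); K-d2/2b (shallow ⟹ clean-bearing; exactly
  clean 1/5-Barlow-close sites with t-robust shells R(t)-dense at every level, via landed `cleanT_clean`); **K-d3 `deepPiece_of_graded :
  CleanlessExcessT → DeepPiece r₀`** (THE DOOR SIDE IS VACUOUS GIVEN THE GRADED LAW — part 2); K-d4/K-d5 compositions `CleanlessExcessT →
  ShallowResidual r₀ → CleanBearingResidual r₀ → UnhostedResidual r₀` (the REGISTERED residual, via landed K6 + K-g1); K-d6 `rdef_iff_four` (RDEF BY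
  NAME ⟺ HostedTarget ∧ CleanlessPiece ∧ DeepPiece ∧ ShallowResidual) and `rdef_of_hosted_graded_shallow`; K-d7 sanity (each piece a RESTRICTION of
  the item it cuts; dial monotonicity `shallowResidual_mono`); K-d8 `shallowWorld` (the residual world below).
* §E  pins (`Iff.rfl`): `deepPiece_ten_iff`, `shallowResidual_ten_iff`, `cleanBearingResidual_ten_iff'` — fully expanded over Mathlib + Literature.

THE RESIDUAL · `ShallowResidual 10` (declared residual of generation 18 if the bundle adopts the cut; ONE literal beyond `CleanBearingResidual 10`, TWO
beyond the registered `UnhostedResidual 10`): unhosted at radius 10, clean-bearing, with MARGIN-UNIFORM Barlow order — at every level `t < 1/200` the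
`t`-robustly clean Barlow sites are `R(t)`-dense (K-d8: exactly clean, 1/5-Barlow-close, t-robust shells).  So the minimal counterexample is a
Barlow-bearing texture WITHOUT amorphous / tcp nodules or bands of unbounded width and WITHOUT unboundedly wide strained-to-the-margin zones, which is
nevertheless TORN at the spacing of its clean sites (dense exactly-gapped 12-shells that are not 1/5-Barlow-close: twin / fault / grain-boundary cores
of non-Barlow local type) or has cores THICKER THAN 10 of bounded depth — the door-type world of the hosted programme (line v7 stubs 2–5) at a larger
but BOUNDED core radius.  STRICTLY WEAKER than `CleanBearingResidual 10` by restriction (K-d7); EQUIVALENT to it — and to `UnhostedResidual 10` — GIVEN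
`CleanlessExcessT` (K-d4/K-d5).  ATTACK = the hosted door laws at bounded depth: K-d8 hands them, at each margin level, a definite density radius; still
lacking are a SINGLE admissible spacing carrying the dense clean sites of all levels (spacing coherence: a recurrence / continuity-in-`a` lemma, not
attempted here) and the matrix collar estimate of crux `OverbindingCap` (stmt-30249).  TAGS: `ShallowResidual 10` XL · door-type · BARRIER-ringed as
its parents (`TetrahedralFrustration` relocated into the graded law, not dissolved); `DeepPiece 10` DISCHARGED given `CleanlessExcessT` (PROVED).

Deps (tree only): parts 1–2; `Theorems.OverbindingBudgetCleanlessCut` (`Hosted`, `CleanBearing`, `CleanBearingResidual`, K3/K6/K7/K9, `cleanT_clean`)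
and through it `Theses.OverbindingBudget` (`RobustDefectLimitWindows` by name); `…WallTensionLever` (`CleanT`, `MAT`, `ThinCores`, `BarlowClose`);
`…ViolatorDensityFloor` (`GT`).  No `instance`, no `notation`, no placeholders.
-/

namespace Summit.AtomisticToContinuum.Crystallization.Theorems.OverbindingBudgetCleanlessCutDepth

open scoped BigOperators Topology
open Literature.MathematicalPhysics.StatisticalMechanics (UniformlyDiscrete IsMuGSC lennardJones groundStateEnergy)
open Literature.Geometry.DiscreteGeometry (ShellCloseTo fccKissingPattern hcpKissingPattern EtaMatched)
open Summit.AtomisticToContinuum.Crystallization.Theses.OverbindingBudget (RobustDefectLimitWindows CubeChargeLaw)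
open Summit.AtomisticToContinuum.Crystallization.Theorems.OverbindingBudgetViolatorDensityFloor (GT)
open Summit.AtomisticToContinuum.Crystallization.Theorems.OverbindingBudgetWallTensionLever (BarlowClose MAT CleanT ThinCores cube_convex closedBall_subset_cube cube_subset_closedBall)
open Summit.AtomisticToContinuum.Crystallization.Theorems.OverbindingBudgetExcessInstability (finite_inter_cube)
open Summit.AtomisticToContinuum.Crystallization.Theorems.OverbindingBudgetPatchTransport (cleanT_transport)
open Summit.AtomisticToContinuum.Crystallization.Theorems.OverbindingBudgetCubeChargeLaw (cubeChargeLaw stub_crossTermSmall)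
open Summit.AtomisticToContinuum.Crystallization.Theorems.OverbindingBudgetCubeBookkeeping (stub_siteSumSplit stub_pairSumLowerBound)
open Summit.AtomisticToContinuum.Crystallization.Theorems.OverbindingBudgetBindingSignLaw (grid_lower_bound)
open Summit.AtomisticToContinuum.Crystallization.Theorems.OverbindingBudgetCubeTails (sum_abs_lennardJones_le_dyadic card_le_of_separated_of_box card_slab_le)
open Summit.AtomisticToContinuum.Crystallization.Theorems.OverbindingBudgetCleanlessCut (Hosted HostedTarget UnhostedResidual CleanBearing CleanlessPiece CleanBearingResidual BareOn CleanlessExcess margin_le_of_cleanT unhostedResidual_iff_pieces cleanlessPiece_of_cleanlessExcess rdef_iff_three rdef_iff_hosted_unhosted thinCores_of_cleanT_recurrent torn_or_thick_of_unhosted hosted_mono unhostedResidual_of_law_residual cleanT_clean cleanBearingResidual_mono bareOn_of_not_cleanBearing finiteDepth_of_cleanBearing)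
open Summit.AtomisticToContinuum.Crystallization.Theorems.OverbindingBudgetGradedBareness (BareOnT CleanlessExcessT ShallowBearing bareOnT_of_bareOn cleanlessExcess_of_graded cleanT_anti bareOnT_mono bareOnT_subset bareOnT_transport CrossAbsSmall crossAbsSmall)
open Summit.AtomisticToContinuum.Crystallization.Theorems.OverbindingBudgetDeepBareExclusion (shallowBearing_of_graded deepBalls_of_not_shallow)

/-! ## §A The two pieces -/

/-- **Piece · `DeepPiece r₀`** (crux-shaped; VACUOUS GIVEN THE GRADED LAW, K-d3): RDEF's hypotheses ∧ ¬Hosted r₀ ∧ CleanBearing ∧ ¬ShallowBearing ⟹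
windows.  World = clean-bearing textures with a DEEP BARE POCKET: at some margin level `t₀ < 1/200`, arbitrarily large balls without any
`t₀`-robustly clean Barlow site — thick amorphous / tcp nodules and bands of unbounded width inside a Barlow-bearing texture. -/
def DeepPiece (r₀ : ℝ) : Prop :=
  ∀ e : ℝ, Filter.Tendsto (fun N : ℕ => Literature.MathematicalPhysics.StatisticalMechanics.groundStateEnergy Literature.MathematicalPhysics.StatisticalMechanics.lennardJones 3 N / N) Filter.atTop (nhds e) → (∀ N : ℕ, 0 < N → e ≤ Literature.MathematicalPhysics.StatisticalMechanics.groundStateEnergy Literature.MathematicalPhysics.StatisticalMechanics.lennardJones 3 N / N) → ∀ x : (N : ℕ) → (Fin N → EuclideanSpace ℝ (Fin 3)), (∀ N, Literature.MathematicalPhysics.StatisticalMechanics.IsGroundState Literature.MathematicalPhysics.StatisticalMechanics.lennardJones (x N)) → ∀ Y : Set (EuclideanSpace ℝ (Fin 3)), (0 : EuclideanSpace ℝ (Fin 3)) ∈ Y → (∀ R ε : ℝ, 0 < ε → ∃ L : ℝ, ∀ p ∈ Y, ∀ q ∈ Y, ∃ q' ∈ Y, dist q' q ≤ L ∧ (∀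 y ∈ Y, dist y p ≤ R → ∃ y' ∈ Y, dist (y' - q') (y - p) ≤ ε) ∧ (∀ y' ∈ Y, dist y' q' ≤ R → ∃ y ∈ Y, dist (y' - q') (y - p) ≤ ε)) → (∃ (φ : ℕ → ℕ) (t : ℕ → EuclideanSpace ℝ (Fin 3)), StrictMono φ ∧ ∀ R ε : ℝ, 0 < ε → ∀ᶠ n in Filter.atTop, (∀ y ∈ Y, ‖y‖ ≤ R → ∃ i : Fin (φ n), dist (x (φ n) i + t n) y ≤ ε) ∧ (∀ i : Fin (φ n), ‖x (φ n) i + t n‖ ≤ R → ∃ y ∈ Y, dist (x (φ n) i + t n) y ≤ ε)) → Literature.MathematicalPhysics.StatisticalMechanics.UniformlyDiscrete Y → Literature.MathematicalPhysics.StatisticalMechanics.IsMuGSC Literature.MathematicalPhysics.StatisticalMechanics.lennardJones e Y → (¬ (∃ a : ℝ, 47 / 50 ≤ a ∧ a ≤ 1 ∧ ∀ y ∈ Y, ({w ∈ Y | w ≠ y ∧ dist y w ≤ a * (1 + 1 / 50)}.ncard = 12 ∧ ∀ w ∈ Y, w ≠ y → a * (1 - 1 / 50) ≤ dist y w ∧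 (dist y w ≤ a * (1 + 1 / 50) ∨ a * (63 / 50) ≤ dist y w)))) → (∀ z : EuclideanSpace ℝ (Fin 3), ∃ w ∈ Y, dist z w < 9 / 10) → (¬ (∃ W : Literature.MathematicalPhysics.StatisticalMechanics.PeriodicConfiguration 3, W.points = Y)) → (∃ ℓ₀ : ℝ, ∀ ℓ : ℝ, ∀ c : EuclideanSpace ℝ (Fin 3), ℓ₀ ≤ ℓ → ((Y ∩ {z | ∀ i : Fin 3, c i ≤ z i ∧ z i < c i + ℓ}).ncard : ℝ) < 2 * ℓ ^ 3) → (∃ ℓ₀ : ℝ, ∀ ℓ : ℝ, ∀ c : EuclideanSpace ℝ (Fin 3), ℓ₀ ≤ ℓ → 5 / 4 * ℓ ^ 3 < ((Y ∩ {z | ∀ i : Fin 3, c i ≤ z i ∧ z i < c i + ℓ}).ncard : ℝ)) → (¬ (∃ a : ℝ, 47 / 50 ≤ a ∧ a ≤ 1 ∧ ∃ K : ℝ, 0 < K ∧ ∃ c : EuclideanSpace ℝ (Fin 3), (∃ y ∈ Y, dist y c ≤ K ∧ ¬ (({v ∈ Y | v ≠ y ∧ dist y v ≤ a * (1 + 1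 / 10)}.ncard = 12 ∧ ∀ v ∈ Y, v ≠ y → a * (1 - 1 / 10) ≤ dist y v ∧ (dist y v ≤ a * (1 + 1 / 10) ∨ a * (63 / 50) ≤ dist y v)) ∧ (∃ T : Finset (EuclideanSpace ℝ (Fin 3)), (↑T : Set (EuclideanSpace ℝ (Fin 3))) = (fun v => a⁻¹ • (v - y)) '' {v ∈ Y | v ≠ y ∧ dist y v ≤ a * (1 + 1 / 10)} ∧ (Literature.Geometry.DiscreteGeometry.ShellCloseTo (2 / 5) T Literature.Geometry.DiscreteGeometry.fccKissingPattern ∨ Literature.Geometry.DiscreteGeometry.ShellCloseTo (2 / 5) T Literature.Geometry.DiscreteGeometry.hcpKissingPattern)))) ∧ (∀ w ∈ Y, K < dist w c → dist w c ≤ 4 * K + 6 → (({v ∈ Y | v ≠ w ∧ dist w v ≤ a * (1 + 1 / 50)}.ncard = 12 ∧ ∀ v ∈ Y, v ≠ w → a * (1 - 1 / 50) ≤ dist w v ∧ (dist w v ≤ a * (1 + 1 / 50) ∨ a * (63 / 50) ≤ dist w v)) ∧ (∃ T : Finset (EuclideanSpace ℝ (Fin 3)), (↑T : Set (EuclideanSpace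 ℝ (Fin 3))) = (fun v => a⁻¹ • (v - w)) '' {v ∈ Y | v ≠ w ∧ dist w v ≤ a * (1 + 1 / 50)} ∧ (Literature.Geometry.DiscreteGeometry.ShellCloseTo (1 / 5) T Literature.Geometry.DiscreteGeometry.fccKissingPattern ∨ Literature.Geometry.DiscreteGeometry.ShellCloseTo (1 / 5) T Literature.Geometry.DiscreteGeometry.hcpKissingPattern)))))) → ((∃ y ∈ Y, (∑' w : ↥Y, Literature.MathematicalPhysics.StatisticalMechanics.lennardJones (dist y (w : EuclideanSpace ℝ (Fin 3)))) < 2 * e) ∧ (∃ y ∈ Y, 2 * e < (∑' w : ↥Y, Literature.MathematicalPhysics.StatisticalMechanics.lennardJones (dist y (w : EuclideanSpace ℝ (Fin 3)))))) → (¬ (∃ κ : ℝ, 0 < κ ∧ (∀ ℓ₀ : ℝ, ∃ ℓ : ℝ, ℓ₀ ≤ ℓ ∧ ∃ c : EuclideanSpace ℝ (Fin 3), ∃ F : Finset (EuclideanSpace ℝ (Fin 3)), (↑F : Set (EuclideanSpace ℝ (Fin 3))) = Y ∩ {z | ∀ i : Fin 3, c i ≤ z i ∧ z i < c i + ℓ}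 ∧ ∃ H : Finset (EuclideanSpace ℝ (Fin 3)), H ⊆ F ∧ 1 / 8 * ((F.card : ℝ) - (H.card : ℝ)) + κ * (F.card : ℝ) ≤ ∑ y ∈ H, ((∑' w : ↥Y, Literature.MathematicalPhysics.StatisticalMechanics.lennardJones (dist y (w : EuclideanSpace ℝ (Fin 3)))) - 2 * e)))) → (∃ L t : ℝ, 0 < t ∧ ∀ q ∈ Y, ∀ a : ℝ, 47 / 50 ≤ a → a ≤ 1 → ∃ y ∈ Y, dist y q ≤ L ∧ ¬ ({w ∈ Y | w ≠ y ∧ dist y w < a * (63 / 50) - t}.ncard ≤ 12 ∧ 12 ≤ {w ∈ Y | w ≠ y ∧ dist y w ≤ a * (1 + 1 / 50) + t}.ncard ∧ ∀ w ∈ Y, w ≠ y → a * (1 - 1 / 50) - t ≤ dist y w ∧ (dist y w ≤ a * (1 + 1 / 50) + t ∨ a * (63 / 50) - t ≤ dist y w))) → ¬ (∃ a : ℝ, 47 / 50 ≤ a ∧ a ≤ 1 ∧ (∀ y ∈ Y, ({w ∈ Y | w ≠ y ∧ dist y w ≤ a * (1 + 1 / 50)}.ncard = 12 ∧ ∀ w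 ∈ Y, w ≠ y → a * (1 - 1 / 50) ≤ dist y w ∧ (dist y w ≤ a * (1 + 1 / 50) ∨ a * (63 / 50) ≤ dist y w)) → (∃ T : Finset (EuclideanSpace ℝ (Fin 3)), (↑T : Set (EuclideanSpace ℝ (Fin 3))) = (fun w => a⁻¹ • (w - y)) '' {w ∈ Y | w ≠ y ∧ dist y w ≤ a * (1 + 1 / 50)} ∧ (Literature.Geometry.DiscreteGeometry.ShellCloseTo (1 / 5) T Literature.Geometry.DiscreteGeometry.fccKissingPattern ∨ Literature.Geometry.DiscreteGeometry.ShellCloseTo (1 / 5) T Literature.Geometry.DiscreteGeometry.hcpKissingPattern))) ∧ (∀ z : EuclideanSpace ℝ (Fin 3), ∃ y ∈ Y, ({w ∈ Y | w ≠ y ∧ dist y w ≤ a * (1 + 1 / 50)}.ncard = 12 ∧ ∀ w ∈ Y, w ≠ y → a * (1 - 1 / 50) ≤ dist y w ∧ (dist y w ≤ a * (1 + 1 / 50) ∨ a * (63 / 50) ≤ dist y w)) ∧ (∃ T : Finset (EuclideanSpace ℝ (Fin 3)), (↑T : Set (EuclideanSpace ℝ (Fin 3))) = (fun w => a⁻¹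 • (w - y)) '' {w ∈ Y | w ≠ y ∧ dist y w ≤ a * (1 + 1 / 50)} ∧ (Literature.Geometry.DiscreteGeometry.ShellCloseTo (1 / 5) T Literature.Geometry.DiscreteGeometry.fccKissingPattern ∨ Literature.Geometry.DiscreteGeometry.ShellCloseTo (1 / 5) T Literature.Geometry.DiscreteGeometry.hcpKissingPattern)) ∧ dist z y ≤ r₀)) → (∃ a : ℝ, 47 / 50 ≤ a ∧ a ≤ 1 ∧ ∃ t : ℝ, 0 < t ∧ ∃ y ∈ Y, ({w ∈ Y | w ≠ y ∧ dist y w ≤ a * (1 + 1 / 50) - t}.ncard = 12 ∧ (∀ w ∈ Y, w ≠ y → a * (1 - 1 / 50) + t ≤ dist y w ∧ (dist y w ≤ a * (1 + 1 / 50) - t ∨ a * (63 / 50) + t ≤ dist y w)) ∧ (∃ T : Finset (EuclideanSpace ℝ (Fin 3)), (↑T : Set (EuclideanSpace ℝ (Fin 3))) = (fun w => a⁻¹ • (w - y)) '' {w ∈ Y | w ≠ y ∧ dist y w ≤ a * (1 + 1 / 50)} ∧ (Literature.Geometry.DiscreteGeometry.ShellCloseTo (1 / 5 - t) T Literature.Geometry.DiscreteGeometry.fccKissingPattern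 ∨ Literature.Geometry.DiscreteGeometry.ShellCloseTo (1 / 5 - t) T Literature.Geometry.DiscreteGeometry.hcpKissingPattern)))) → ¬ (∀ t : ℝ, 0 < t → t < 1 / 200 → ∃ R : ℝ, ∀ c : EuclideanSpace ℝ (Fin 3), ∃ y ∈ Y, dist y c ≤ R ∧ ∃ a : ℝ, 47 / 50 ≤ a ∧ a ≤ 1 ∧ ({w ∈ Y | w ≠ y ∧ dist y w ≤ a * (1 + 1 / 50) - t}.ncard = 12 ∧ (∀ w ∈ Y, w ≠ y → a * (1 - 1 / 50) + t ≤ dist y w ∧ (dist y w ≤ a * (1 + 1 / 50) - t ∨ a * (63 / 50) + t ≤ dist y w)) ∧ (∃ T : Finset (EuclideanSpace ℝ (Fin 3)), (↑T : Set (EuclideanSpace ℝ (Fin 3))) = (fun w => a⁻¹ • (w - y)) '' {w ∈ Y | w ≠ y ∧ dist y w ≤ a * (1 + 1 / 50)} ∧ (Literature.Geometry.DiscreteGeometry.ShellCloseTo (1 / 5 - t) T Literature.Geometry.DiscreteGeometry.fccKissingPattern ∨ Literature.Geometry.DiscreteGeometry.ShellCloseTo (1 / 5 - t) T Literature.Geometry.DiscreteGeometry.hcpKissingPattern))))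 → ∃ W : Literature.MathematicalPhysics.StatisticalMechanics.PeriodicConfiguration 3, ∀ R ε : ℝ, 0 < ε → ∃ᶠ N in Filter.atTop, ∃ t : EuclideanSpace ℝ (Fin 3), (∀ s ∈ W.points, ‖s‖ ≤ R → ∃ i : Fin N, dist (x N i + t) s ≤ ε) ∧ (∀ i : Fin N, ‖x N i + t‖ ≤ R → ∃ s ∈ W.points, dist (x N i + t) s ≤ ε)

/-- **Residual · `ShallowResidual r₀`** (at `r₀ = 10` THE declared residual of generation 18 = normal form N6 of the minimal counterexample, ONE literal beyond
`CleanBearingResidual 10`): RDEF's hypotheses ∧ ¬Hosted r₀ ∧ CleanBearing ∧ ShallowBearing ⟹ windows.  «The minimal counterexample has no host at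
radius 10 but has margin-uniform Barlow order: at every level `t ∈ (0, 1/200)` its `t`-robustly clean Barlow sites are `R(t)`-dense — it is TORN
(dense exactly-gapped 12-shells that are not 1/5-Barlow-close) or its cores are thicker than 10 but of BOUNDED DEPTH at every margin.» -/
def ShallowResidual (r₀ : ℝ) : Prop :=
  ∀ e : ℝ, Filter.Tendsto (fun N : ℕ => Literature.MathematicalPhysics.StatisticalMechanics.groundStateEnergy Literature.MathematicalPhysics.StatisticalMechanics.lennardJones 3 N / N) Filter.atTop (nhds e) → (∀ N : ℕ, 0 < N → e ≤ Literature.MathematicalPhysics.StatisticalMechanics.groundStateEnergy Literature.MathematicalPhysics.StatisticalMechanics.lennardJones 3 N / N) → ∀ x : (N : ℕ) → (Fin N → EuclideanSpace ℝ (Fin 3)), (∀ N, Literature.MathematicalPhysics.StatisticalMechanics.IsGroundState Literature.MathematicalPhysics.StatisticalMechanics.lennardJones (x N)) → ∀ Y : Set (EuclideanSpace ℝ (Fin 3)), (0 : EuclideanSpace ℝ (Fin 3)) ∈ Y → (∀ R ε : ℝ, 0 < ε → ∃ L : ℝ, ∀ p ∈ Y, ∀ q ∈ Y, ∃ q' ∈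 Y, dist q' q ≤ L ∧ (∀ y ∈ Y, dist y p ≤ R → ∃ y' ∈ Y, dist (y' - q') (y - p) ≤ ε) ∧ (∀ y' ∈ Y, dist y' q' ≤ R → ∃ y ∈ Y, dist (y' - q') (y - p) ≤ ε)) → (∃ (φ : ℕ → ℕ) (t : ℕ → EuclideanSpace ℝ (Fin 3)), StrictMono φ ∧ ∀ R ε : ℝ, 0 < ε → ∀ᶠ n in Filter.atTop, (∀ y ∈ Y, ‖y‖ ≤ R → ∃ i : Fin (φ n), dist (x (φ n) i + t n) y ≤ ε) ∧ (∀ i : Fin (φ n), ‖x (φ n) i + t n‖ ≤ R → ∃ y ∈ Y, dist (x (φ n) i + t n) y ≤ ε)) → Literature.MathematicalPhysics.StatisticalMechanics.UniformlyDiscrete Y → Literature.MathematicalPhysics.StatisticalMechanics.IsMuGSC Literature.MathematicalPhysics.StatisticalMechanics.lennardJones e Y → (¬ (∃ a : ℝ, 47 / 50 ≤ a ∧ a ≤ 1 ∧ ∀ y ∈ Y, ({w ∈ Y | w ≠ y ∧ dist y w ≤ a * (1 + 1 / 50)}.ncard = 12 ∧ ∀ w ∈ Y, w ≠ y → a * (1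 - 1 / 50) ≤ dist y w ∧ (dist y w ≤ a * (1 + 1 / 50) ∨ a * (63 / 50) ≤ dist y w)))) → (∀ z : EuclideanSpace ℝ (Fin 3), ∃ w ∈ Y, dist z w < 9 / 10) → (¬ (∃ W : Literature.MathematicalPhysics.StatisticalMechanics.PeriodicConfiguration 3, W.points = Y)) → (∃ ℓ₀ : ℝ, ∀ ℓ : ℝ, ∀ c : EuclideanSpace ℝ (Fin 3), ℓ₀ ≤ ℓ → ((Y ∩ {z | ∀ i : Fin 3, c i ≤ z i ∧ z i < c i + ℓ}).ncard : ℝ) < 2 * ℓ ^ 3) → (∃ ℓ₀ : ℝ, ∀ ℓ : ℝ, ∀ c : EuclideanSpace ℝ (Fin 3), ℓ₀ ≤ ℓ → 5 / 4 * ℓ ^ 3 < ((Y ∩ {z | ∀ i : Fin 3, c i ≤ z i ∧ z i < c i + ℓ}).ncard : ℝ)) → (¬ (∃ a : ℝ, 47 / 50 ≤ a ∧ a ≤ 1 ∧ ∃ K : ℝ, 0 < K ∧ ∃ c : EuclideanSpace ℝ (Fin 3), (∃ y ∈ Y, dist y c ≤ K ∧ ¬ (({v ∈ Y | v ≠ y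 ∧ dist y v ≤ a * (1 + 1 / 10)}.ncard = 12 ∧ ∀ v ∈ Y, v ≠ y → a * (1 - 1 / 10) ≤ dist y v ∧ (dist y v ≤ a * (1 + 1 / 10) ∨ a * (63 / 50) ≤ dist y v)) ∧ (∃ T : Finset (EuclideanSpace ℝ (Fin 3)), (↑T : Set (EuclideanSpace ℝ (Fin 3))) = (fun v => a⁻¹ • (v - y)) '' {v ∈ Y | v ≠ y ∧ dist y v ≤ a * (1 + 1 / 10)} ∧ (Literature.Geometry.DiscreteGeometry.ShellCloseTo (2 / 5) T Literature.Geometry.DiscreteGeometry.fccKissingPattern ∨ Literature.Geometry.DiscreteGeometry.ShellCloseTo (2 / 5) T Literature.Geometry.DiscreteGeometry.hcpKissingPattern)))) ∧ (∀ w ∈ Y, K < dist w c → dist w c ≤ 4 * K + 6 → (({v ∈ Y | v ≠ w ∧ dist w v ≤ a * (1 + 1 / 50)}.ncard = 12 ∧ ∀ v ∈ Y, v ≠ w → a * (1 - 1 / 50) ≤ dist w v ∧ (dist w v ≤ a * (1 + 1 / 50) ∨ a * (63 / 50) ≤ dist w v)) ∧ (∃ T : Finset (EuclideanSpace ℝ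 (Fin 3)), (↑T : Set (EuclideanSpace ℝ (Fin 3))) = (fun v => a⁻¹ • (v - w)) '' {v ∈ Y | v ≠ w ∧ dist w v ≤ a * (1 + 1 / 50)} ∧ (Literature.Geometry.DiscreteGeometry.ShellCloseTo (1 / 5) T Literature.Geometry.DiscreteGeometry.fccKissingPattern ∨ Literature.Geometry.DiscreteGeometry.ShellCloseTo (1 / 5) T Literature.Geometry.DiscreteGeometry.hcpKissingPattern)))))) → ((∃ y ∈ Y, (∑' w : ↥Y, Literature.MathematicalPhysics.StatisticalMechanics.lennardJones (dist y (w : EuclideanSpace ℝ (Fin 3)))) < 2 * e) ∧ (∃ y ∈ Y, 2 * e < (∑' w : ↥Y, Literature.MathematicalPhysics.StatisticalMechanics.lennardJones (dist y (w : EuclideanSpace ℝ (Fin 3)))))) → (¬ (∃ κ : ℝ, 0 < κ ∧ (∀ ℓ₀ : ℝ, ∃ ℓ : ℝ, ℓ₀ ≤ ℓ ∧ ∃ c : EuclideanSpace ℝ (Fin 3), ∃ F : Finset (EuclideanSpace ℝ (Fin 3)), (↑F : Set (EuclideanSpace ℝ (Fin 3))) = Y ∩ {z | ∀ i : Fin 3,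 c i ≤ z i ∧ z i < c i + ℓ} ∧ ∃ H : Finset (EuclideanSpace ℝ (Fin 3)), H ⊆ F ∧ 1 / 8 * ((F.card : ℝ) - (H.card : ℝ)) + κ * (F.card : ℝ) ≤ ∑ y ∈ H, ((∑' w : ↥Y, Literature.MathematicalPhysics.StatisticalMechanics.lennardJones (dist y (w : EuclideanSpace ℝ (Fin 3)))) - 2 * e)))) → (∃ L t : ℝ, 0 < t ∧ ∀ q ∈ Y, ∀ a : ℝ, 47 / 50 ≤ a → a ≤ 1 → ∃ y ∈ Y, dist y q ≤ L ∧ ¬ ({w ∈ Y | w ≠ y ∧ dist y w < a * (63 / 50) - t}.ncard ≤ 12 ∧ 12 ≤ {w ∈ Y | w ≠ y ∧ dist y w ≤ a * (1 + 1 / 50) + t}.ncard ∧ ∀ w ∈ Y, w ≠ y → a * (1 - 1 / 50) - t ≤ dist y w ∧ (dist y w ≤ a * (1 + 1 / 50) + t ∨ a * (63 / 50) - t ≤ dist y w))) → ¬ (∃ a : ℝ, 47 / 50 ≤ a ∧ a ≤ 1 ∧ (∀ y ∈ Y, ({w ∈ Y | w ≠ y ∧ dist y w ≤ a * (1 + 1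 / 50)}.ncard = 12 ∧ ∀ w ∈ Y, w ≠ y → a * (1 - 1 / 50) ≤ dist y w ∧ (dist y w ≤ a * (1 + 1 / 50) ∨ a * (63 / 50) ≤ dist y w)) → (∃ T : Finset (EuclideanSpace ℝ (Fin 3)), (↑T : Set (EuclideanSpace ℝ (Fin 3))) = (fun w => a⁻¹ • (w - y)) '' {w ∈ Y | w ≠ y ∧ dist y w ≤ a * (1 + 1 / 50)} ∧ (Literature.Geometry.DiscreteGeometry.ShellCloseTo (1 / 5) T Literature.Geometry.DiscreteGeometry.fccKissingPattern ∨ Literature.Geometry.DiscreteGeometry.ShellCloseTo (1 / 5) T Literature.Geometry.DiscreteGeometry.hcpKissingPattern))) ∧ (∀ z : EuclideanSpace ℝ (Fin 3), ∃ y ∈ Y, ({w ∈ Y | w ≠ y ∧ dist y w ≤ a * (1 + 1 / 50)}.ncard = 12 ∧ ∀ w ∈ Y, w ≠ y → a * (1 - 1 / 50) ≤ dist y w ∧ (dist y w ≤ a * (1 + 1 / 50) ∨ a * (63 / 50) ≤ dist y w)) ∧ (∃ T : Finset (EuclideanSpace ℝ (Fin 3)), (↑T : Set (EuclideanSpace ℝ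 (Fin 3))) = (fun w => a⁻¹ • (w - y)) '' {w ∈ Y | w ≠ y ∧ dist y w ≤ a * (1 + 1 / 50)} ∧ (Literature.Geometry.DiscreteGeometry.ShellCloseTo (1 / 5) T Literature.Geometry.DiscreteGeometry.fccKissingPattern ∨ Literature.Geometry.DiscreteGeometry.ShellCloseTo (1 / 5) T Literature.Geometry.DiscreteGeometry.hcpKissingPattern)) ∧ dist z y ≤ r₀)) → (∃ a : ℝ, 47 / 50 ≤ a ∧ a ≤ 1 ∧ ∃ t : ℝ, 0 < t ∧ ∃ y ∈ Y, ({w ∈ Y | w ≠ y ∧ dist y w ≤ a * (1 + 1 / 50) - t}.ncard = 12 ∧ (∀ w ∈ Y, w ≠ y → a * (1 - 1 / 50) + t ≤ dist y w ∧ (dist y w ≤ a * (1 + 1 / 50) - t ∨ a * (63 / 50) + t ≤ dist y w)) ∧ (∃ T : Finset (EuclideanSpace ℝ (Fin 3)), (↑T : Set (EuclideanSpace ℝ (Fin 3))) = (fun w => a⁻¹ • (w - y)) '' {w ∈ Y | w ≠ y ∧ dist y w ≤ a * (1 + 1 / 50)} ∧ (Literature.Geometry.DiscreteGeometry.ShellCloseTo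 (1 / 5 - t) T Literature.Geometry.DiscreteGeometry.fccKissingPattern ∨ Literature.Geometry.DiscreteGeometry.ShellCloseTo (1 / 5 - t) T Literature.Geometry.DiscreteGeometry.hcpKissingPattern)))) → (∀ t : ℝ, 0 < t → t < 1 / 200 → ∃ R : ℝ, ∀ c : EuclideanSpace ℝ (Fin 3), ∃ y ∈ Y, dist y c ≤ R ∧ ∃ a : ℝ, 47 / 50 ≤ a ∧ a ≤ 1 ∧ ({w ∈ Y | w ≠ y ∧ dist y w ≤ a * (1 + 1 / 50) - t}.ncard = 12 ∧ (∀ w ∈ Y, w ≠ y → a * (1 - 1 / 50) + t ≤ dist y w ∧ (dist y w ≤ a * (1 + 1 / 50) - t ∨ a * (63 / 50) + t ≤ dist y w)) ∧ (∃ T : Finset (EuclideanSpace ℝ (Fin 3)), (↑T : Set (EuclideanSpace ℝ (Fin 3))) = (fun w => a⁻¹ • (w - y)) '' {w ∈ Y | w ≠ y ∧ dist y w ≤ a * (1 + 1 / 50)} ∧ (Literature.Geometry.DiscreteGeometry.ShellCloseTo (1 / 5 - t) T Literature.Geometry.DiscreteGeometry.fccKissingPattern ∨ Literature.Geometry.DiscreteGeometry.ShellCloseTo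 (1 / 5 - t) T Literature.Geometry.DiscreteGeometry.hcpKissingPattern)))) → ∃ W : Literature.MathematicalPhysics.StatisticalMechanics.PeriodicConfiguration 3, ∀ R ε : ℝ, 0 < ε → ∃ᶠ N in Filter.atTop, ∃ t : EuclideanSpace ℝ (Fin 3), (∀ s ∈ W.points, ‖s‖ ≤ R → ∃ i : Fin N, dist (x N i + t) s ≤ ε) ∧ (∀ i : Fin N, ‖x N i + t‖ ≤ R → ∃ s ∈ W.points, dist (x N i + t) s ≤ ε)

/-! ## §D The cut of `CleanBearingResidual r₀` and its kernels -/

/-- **K-d1 (THE CUT IS EXACT).** `CleanBearingResidual r₀ ⟺ DeepPiece r₀ ∧ ShallowResidual r₀` — excluded middle on `ShallowBearing Y`. -/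
theorem cleanBearingResidual_iff_pieces (r₀ : ℝ) : CleanBearingResidual r₀ ↔ (DeepPiece r₀ ∧ ShallowResidual r₀) := by
  unfold CleanBearingResidual DeepPiece ShallowResidual
  constructor
  · intro h
    exact ⟨fun e hT hlb x hx Y h0 hrec hlim hUD hμ hgap hsolid haper hup hlow hacc htwo hthin hrob hnh hcb _ => h e hT hlb x hx Y h0 hrec hlim hUD hμ hgap hsolid haper hup hlow hacc htwo hthin hrob hnh hcb, fun e hT hlb x hx Y h0 hrec hlim hUD hμ hgap hsolid haper hup hlow hacc htwo hthin hrob hnh hcb _ => h e hT hlb x hx Y h0 hrec hlim hUD hμ hgap hsolid haper hup hlow hacc htwo hthin hrob hnh hcb⟩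
  · rintro ⟨h₁, h₂⟩ e hT hlb x hx Y h0 hrec hlim hUD hμ hgap hsolid haper hup hlow hacc htwo hthin hrob hnh hcb
    by_cases hs : ShallowBearing Y
    · exact h₂ e hT hlb x hx Y h0 hrec hlim hUD hμ hgap hsolid haper hup hlow hacc htwo hthin hrob hnh hcb hs
    · exact h₁ e hT hlb x hx Y h0 hrec hlim hUD hμ hgap hsolid haper hup hlow hacc htwo hthin hrob hnh hcb hs

/-- **K-d2.** Margin-uniform Barlow order implies clean-bearing (take the level `t = 1/400`). -/
theorem cleanBearing_of_shallowBearing {Y : Set (EuclideanSpace ℝ (Fin 3))} (h : ShallowBearing Y) : CleanBearing Y := by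
  obtain ⟨R, hR⟩ := h (1 / 400) (by norm_num) (by norm_num)
  obtain ⟨y, hy, -, a, ha1, ha2, hc⟩ := hR 0
  exact ⟨a, ha1, ha2, 1 / 400, by norm_num, y, hy, hc⟩

/-- **K-d2b.** In the margin-uniform world the EXACTLY clean Barlow-close sites with `t`-robust shells are `R(t)`-dense at every level `t < 1/200`. -/
theorem cleanDense_of_shallowBearing {Y : Set (EuclideanSpace ℝ (Fin 3))} (h : ShallowBearing Y) {t : ℝ} (ht : 0 < t) (ht' : t < 1 / 200) :
    ∃ R : ℝ, ∀ c : EuclideanSpace ℝ (Fin 3), ∃ y ∈ Y, dist y c ≤ R ∧ ∃ a : ℝ, 47 / 50 ≤ a ∧ a ≤ 1 ∧ CleanT a t Y y ∧ GT a Y y ∧ BarlowClose a Y y := by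
  obtain ⟨R, hR⟩ := h t ht ht'
  refine ⟨R, fun c => ?_⟩
  obtain ⟨y, hy, hd, a, ha1, ha2, hc⟩ := hR c
  obtain ⟨hg, hb⟩ := cleanT_clean (by linarith) ht.le hc
  exact ⟨y, hy, hd, a, ha1, ha2, hc, hg, hb⟩

/-- **K-d3 (THE DOOR SIDE IS VACUOUS GIVEN THE GRADED LAW).**  `CleanlessExcessT ⟹ DeepPiece r₀` for every `r₀`: the depth kernel
`shallowBearing_of_graded` contradicts the piece's `¬ShallowBearing` literal outright (of RDEF's twenty hypotheses only TEND, LB, recurrence,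
uniform discreteness, μ-stability and the covering radius are consumed; `¬Hosted`, `CleanBearing` and the GS data are not). -/
theorem deepPiece_of_graded (r₀ : ℝ) (hCE : CleanlessExcessT) : DeepPiece r₀ := by
  unfold DeepPiece
  intro e hT hlb x hx Y h0 hrec hlim hUD hμ hgap hsolid haper hup hlow hacc htwo hthin hrob _hnh _hcb hns
  exact absurd (shallowBearing_of_graded hCE hT hlb hrec hUD hμ hsolid) hns

/-- **K-d4 (composition at node level).**  Graded law ∧ shallow residual ⟹ the generation-17 residual. -/
theorem cleanBearingResidual_of_graded_shallow {r₀ : ℝ} (hCE : CleanlessExcessT) (hR : ShallowResidual r₀) : CleanBearingResidual r₀ :=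
  (cleanBearingResidual_iff_pieces r₀).2 ⟨deepPiece_of_graded r₀ hCE, hR⟩

/-- **K-d5 (composition down to the REGISTERED residual).**  Graded law ∧ shallow residual ⟹ `UnhostedResidual r₀` (at `r₀ = 10`: the registered
stub `stub_unhostedResidual` of line v7, via the landed K6 and K-g1). -/
theorem unhostedResidual_of_graded_shallow {r₀ : ℝ} (hCE : CleanlessExcessT) (hR : ShallowResidual r₀) : UnhostedResidual r₀ :=
  unhostedResidual_of_law_residual (cleanlessExcess_of_graded hCE) (cleanBearingResidual_of_graded_shallow hCE hR)

/-- **K-d6 (lineage chain).**  RDEF (the crux, BY NAME) ⟺ HostedTarget r₀ ∧ CleanlessPiece r₀ ∧ DeepPiece r₀ ∧ ShallowResidual r₀. -/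
theorem rdef_iff_four (r₀ : ℝ) :
    RobustDefectLimitWindows ↔ (HostedTarget r₀ ∧ CleanlessPiece r₀ ∧ DeepPiece r₀ ∧ ShallowResidual r₀) := by
  rw [rdef_iff_three r₀, cleanBearingResidual_iff_pieces r₀]

/-- **K-d6′.**  Hosted target ∧ graded law ∧ shallow residual ⟹ the crux (by name): given the graded law, BOTH door-side pieces of generations 17
and 18 are discharged, and the crux reduces to the hosted programme (line v7 stubs 1–5) plus `ShallowResidual r₀`. -/
theorem rdef_of_hosted_graded_shallow {r₀ : ℝ} (hH : HostedTarget r₀) (hCE : CleanlessExcessT) (hR : ShallowResidual r₀) :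
    RobustDefectLimitWindows :=
  (rdef_iff_hosted_unhosted r₀).2 ⟨hH, unhostedResidual_of_graded_shallow hCE hR⟩

/-- **K-d7 (sanity: the pieces are RESTRICTIONS — never stronger than the item they cut).** -/
theorem shallowResidual_of_cleanBearingResidual (r₀ : ℝ) (h : CleanBearingResidual r₀) : ShallowResidual r₀ :=
  ((cleanBearingResidual_iff_pieces r₀).1 h).2

/-- **K-d7′.** -/
theorem deepPiece_of_cleanBearingResidual (r₀ : ℝ) (h : CleanBearingResidual r₀) : DeepPiece r₀ :=
  ((cleanBearingResidual_iff_pieces r₀).1 h).1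

/-- **K-d7″.** The declared residual is a restriction of the crux. -/
theorem shallowResidual_of_rdef (r₀ : ℝ) (h : RobustDefectLimitWindows) : ShallowResidual r₀ :=
  ((rdef_iff_four r₀).1 h).2.2.2

/-- **K-d7‴ (dial monotonicity).** The shallow residual is monotone (weaker) in the core radius. -/
theorem shallowResidual_mono {r r' : ℝ} (h : r ≤ r') (hR : ShallowResidual r) : ShallowResidual r' := by
  unfold ShallowResidual at hR ⊢
  intro e hT hlb x hx Y h0 hrec hlim hUD hμ hgap hsolid haper hup hlow hacc htwo hthin hrob hnh hcb hs
  exact hR e hT hlb x hx Y h0 hrec hlim hUD hμ hgap hsolid haper hup hlow hacc htwo hthin hrob (fun hh => hnh (hosted_mono h hh)) hcb hs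

/-- **K-d8 (THE RESIDUAL WORLD).**  Under RDEF's standing hypotheses a shallow-bearing texture unhosted at `r₀` has, at EVERY level `t < 1/200`,
`t`-robustly clean Barlow sites `R(t)`-dense (K-d2b) and, at the spacing of any one of them, clean Barlow-close sites within a finite distance of every
point — where it is TORN (`¬MAT`) or has a core THICKER than `r₀` (generation-17 K9/K9′). -/
theorem shallowWorld {r₀ : ℝ} {Y : Set (EuclideanSpace ℝ (Fin 3))} (hUD : UniformlyDiscrete Y)
    (hrec : (∀ R ε : ℝ, 0 < ε → ∃ L : ℝ, ∀ p ∈ Y, ∀ q ∈ Y, ∃ q' ∈ Y, dist q' q ≤ L ∧ (∀ y ∈ Y, dist y p ≤ R → ∃ y' ∈ Y, dist (y' - q') (y - p) ≤ ε) ∧ (∀ y' ∈ Y, dist y' q' ≤ R → ∃ y ∈ Y, dist (y' - q') (y - p) ≤ ε)))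
    (hsolid : (∀ z : EuclideanSpace ℝ (Fin 3), ∃ w ∈ Y, dist z w < 9 / 10))
    (hnh : ¬ Hosted r₀ Y) (hs : ShallowBearing Y) :
    (∀ t : ℝ, 0 < t → t < 1 / 200 → ∃ R : ℝ, ∀ c : EuclideanSpace ℝ (Fin 3), ∃ y ∈ Y, dist y c ≤ R ∧ ∃ a : ℝ, 47 / 50 ≤ a ∧ a ≤ 1 ∧
      CleanT a t Y y ∧ GT a Y y ∧ BarlowClose a Y y) ∧
    ∃ a : ℝ, 47 / 50 ≤ a ∧ a ≤ 1 ∧ ∃ r : ℝ, ThinCores a r Y ∧ (¬ MAT a Y ∨ (¬ ThinCores a r₀ Y ∧ r₀ < r)) := by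
  refine ⟨fun t ht ht' => cleanDense_of_shallowBearing hs ht ht', ?_⟩
  obtain ⟨a, ha1, ha2, -, r, hr⟩ := finiteDepth_of_cleanBearing hUD hrec hsolid (cleanBearing_of_shallowBearing hs)
  exact ⟨a, ha1, ha2, r, hr, torn_or_thick_of_unhosted hnh ha1 ha2 hr⟩

/-! ## §E Pins (`Iff.rfl`) — the readable predicates ARE the lineage texts -/

/-- PIN · the declared residual of generation 17 at `r₀ = 10`, fully expanded (= landed `cleanBearingResidual_ten_iff`; restated so this file is
self-contained for the next registration bundle). -/
theorem cleanBearingResidual_ten_iff' : CleanBearingResidual 10 ↔ (∀ e : ℝ, Filter.Tendsto (fun N : ℕ => Literature.MathematicalPhysics.StatisticalMechanics.groundStateEnergy Literature.MathematicalPhysics.StatisticalMechanics.lennardJones 3 N / N) Filter.atTop (nhds e) → (∀ N : ℕ, 0 < N → e ≤ Literature.MathematicalPhysics.StatisticalMechanics.groundStateEnergy Literature.MathematicalPhysics.StatisticalMechanics.lennardJones 3 N / N) → ∀ x : (N : ℕ) → (Fin N → EuclideanSpace ℝ (Fin 3)), (∀ N, Literature.MathematicalPhysics.StatisticalMechanics.IsGroundState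 Literature.MathematicalPhysics.StatisticalMechanics.lennardJones (x N)) → ∀ Y : Set (EuclideanSpace ℝ (Fin 3)), (0 : EuclideanSpace ℝ (Fin 3)) ∈ Y → (∀ R ε : ℝ, 0 < ε → ∃ L : ℝ, ∀ p ∈ Y, ∀ q ∈ Y, ∃ q' ∈ Y, dist q' q ≤ L ∧ (∀ y ∈ Y, dist y p ≤ R → ∃ y' ∈ Y, dist (y' - q') (y - p) ≤ ε) ∧ (∀ y' ∈ Y, dist y' q' ≤ R → ∃ y ∈ Y, dist (y' - q') (y - p) ≤ ε)) → (∃ (φ : ℕ → ℕ) (t : ℕ → EuclideanSpace ℝ (Fin 3)), StrictMono φ ∧ ∀ R ε : ℝ, 0 < ε → ∀ᶠ n in Filter.atTop, (∀ y ∈ Y, ‖y‖ ≤ R → ∃ i : Fin (φ n), dist (x (φ n) i + t n) y ≤ ε) ∧ (∀ i : Fin (φ n), ‖x (φ n) i + t n‖ ≤ R → ∃ y ∈ Y, dist (x (φ n) i + t n) y ≤ ε)) → Literature.MathematicalPhysics.StatisticalMechanics.UniformlyDiscrete Y → Literature.MathematicalPhysics.StatisticalMechanics.IsMuGSC Literature.MathematicalPhysics.StatisticalMechanics.lennardJones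 e Y → (¬ (∃ a : ℝ, 47 / 50 ≤ a ∧ a ≤ 1 ∧ ∀ y ∈ Y, ({w ∈ Y | w ≠ y ∧ dist y w ≤ a * (1 + 1 / 50)}.ncard = 12 ∧ ∀ w ∈ Y, w ≠ y → a * (1 - 1 / 50) ≤ dist y w ∧ (dist y w ≤ a * (1 + 1 / 50) ∨ a * (63 / 50) ≤ dist y w)))) → (∀ z : EuclideanSpace ℝ (Fin 3), ∃ w ∈ Y, dist z w < 9 / 10) → (¬ (∃ W : Literature.MathematicalPhysics.StatisticalMechanics.PeriodicConfiguration 3, W.points = Y)) → (∃ ℓ₀ : ℝ, ∀ ℓ : ℝ, ∀ c : EuclideanSpace ℝ (Fin 3), ℓ₀ ≤ ℓ → ((Y ∩ {z | ∀ i : Fin 3, c i ≤ z i ∧ z i < c i + ℓ}).ncard : ℝ) < 2 * ℓ ^ 3) → (∃ ℓ₀ : ℝ, ∀ ℓ : ℝ, ∀ c : EuclideanSpace ℝ (Fin 3), ℓ₀ ≤ ℓ → 5 / 4 * ℓ ^ 3 < ((Y ∩ {z | ∀ i : Fin 3, c i ≤ z i ∧ z i < c i + ℓ}).ncard : ℝ))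 → (¬ (∃ a : ℝ, 47 / 50 ≤ a ∧ a ≤ 1 ∧ ∃ K : ℝ, 0 < K ∧ ∃ c : EuclideanSpace ℝ (Fin 3), (∃ y ∈ Y, dist y c ≤ K ∧ ¬ (({v ∈ Y | v ≠ y ∧ dist y v ≤ a * (1 + 1 / 10)}.ncard = 12 ∧ ∀ v ∈ Y, v ≠ y → a * (1 - 1 / 10) ≤ dist y v ∧ (dist y v ≤ a * (1 + 1 / 10) ∨ a * (63 / 50) ≤ dist y v)) ∧ (∃ T : Finset (EuclideanSpace ℝ (Fin 3)), (↑T : Set (EuclideanSpace ℝ (Fin 3))) = (fun v => a⁻¹ • (v - y)) '' {v ∈ Y | v ≠ y ∧ dist y v ≤ a * (1 + 1 / 10)} ∧ (Literature.Geometry.DiscreteGeometry.ShellCloseTo (2 / 5) T Literature.Geometry.DiscreteGeometry.fccKissingPattern ∨ Literature.Geometry.DiscreteGeometry.ShellCloseTo (2 / 5) T Literature.Geometry.DiscreteGeometry.hcpKissingPattern)))) ∧ (∀ w ∈ Y, K < dist w c → dist w c ≤ 4 * K + 6 → (({v ∈ Y | v ≠ w ∧ dist w v ≤ a * (1 + 1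 / 50)}.ncard = 12 ∧ ∀ v ∈ Y, v ≠ w → a * (1 - 1 / 50) ≤ dist w v ∧ (dist w v ≤ a * (1 + 1 / 50) ∨ a * (63 / 50) ≤ dist w v)) ∧ (∃ T : Finset (EuclideanSpace ℝ (Fin 3)), (↑T : Set (EuclideanSpace ℝ (Fin 3))) = (fun v => a⁻¹ • (v - w)) '' {v ∈ Y | v ≠ w ∧ dist w v ≤ a * (1 + 1 / 50)} ∧ (Literature.Geometry.DiscreteGeometry.ShellCloseTo (1 / 5) T Literature.Geometry.DiscreteGeometry.fccKissingPattern ∨ Literature.Geometry.DiscreteGeometry.ShellCloseTo (1 / 5) T Literature.Geometry.DiscreteGeometry.hcpKissingPattern)))))) → ((∃ y ∈ Y, (∑' w : ↥Y, Literature.MathematicalPhysics.StatisticalMechanics.lennardJones (dist y (w : EuclideanSpace ℝ (Fin 3)))) < 2 * e) ∧ (∃ y ∈ Y, 2 * e < (∑' w : ↥Y, Literature.MathematicalPhysics.StatisticalMechanics.lennardJones (dist y (w : EuclideanSpace ℝ (Fin 3)))))) → (¬ (∃ κ : ℝ, 0 < κ ∧ (∀ ℓ₀ : ℝ, ∃ ℓ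 : ℝ, ℓ₀ ≤ ℓ ∧ ∃ c : EuclideanSpace ℝ (Fin 3), ∃ F : Finset (EuclideanSpace ℝ (Fin 3)), (↑F : Set (EuclideanSpace ℝ (Fin 3))) = Y ∩ {z | ∀ i : Fin 3, c i ≤ z i ∧ z i < c i + ℓ} ∧ ∃ H : Finset (EuclideanSpace ℝ (Fin 3)), H ⊆ F ∧ 1 / 8 * ((F.card : ℝ) - (H.card : ℝ)) + κ * (F.card : ℝ) ≤ ∑ y ∈ H, ((∑' w : ↥Y, Literature.MathematicalPhysics.StatisticalMechanics.lennardJones (dist y (w : EuclideanSpace ℝ (Fin 3)))) - 2 * e)))) → (∃ L t : ℝ, 0 < t ∧ ∀ q ∈ Y, ∀ a : ℝ, 47 / 50 ≤ a → a ≤ 1 → ∃ y ∈ Y, dist y q ≤ L ∧ ¬ ({w ∈ Y | w ≠ y ∧ dist y w < a * (63 / 50) - t}.ncard ≤ 12 ∧ 12 ≤ {w ∈ Y | w ≠ y ∧ dist y w ≤ a * (1 + 1 / 50) + t}.ncard ∧ ∀ w ∈ Y, w ≠ y → a * (1 - 1 / 50) - t ≤ dist y w ∧ (dist y w ≤ a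 * (1 + 1 / 50) + t ∨ a * (63 / 50) - t ≤ dist y w))) → ¬ (∃ a : ℝ, 47 / 50 ≤ a ∧ a ≤ 1 ∧ (∀ y ∈ Y, ({w ∈ Y | w ≠ y ∧ dist y w ≤ a * (1 + 1 / 50)}.ncard = 12 ∧ ∀ w ∈ Y, w ≠ y → a * (1 - 1 / 50) ≤ dist y w ∧ (dist y w ≤ a * (1 + 1 / 50) ∨ a * (63 / 50) ≤ dist y w)) → (∃ T : Finset (EuclideanSpace ℝ (Fin 3)), (↑T : Set (EuclideanSpace ℝ (Fin 3))) = (fun w => a⁻¹ • (w - y)) '' {w ∈ Y | w ≠ y ∧ dist y w ≤ a * (1 + 1 / 50)} ∧ (Literature.Geometry.DiscreteGeometry.ShellCloseTo (1 / 5) T Literature.Geometry.DiscreteGeometry.fccKissingPattern ∨ Literature.Geometry.DiscreteGeometry.ShellCloseTo (1 / 5) T Literature.Geometry.DiscreteGeometry.hcpKissingPattern))) ∧ (∀ z : EuclideanSpace ℝ (Fin 3), ∃ y ∈ Y, ({w ∈ Y | w ≠ y ∧ dist y w ≤ a * (1 + 1 / 50)}.ncard = 12 ∧ ∀ w ∈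 Y, w ≠ y → a * (1 - 1 / 50) ≤ dist y w ∧ (dist y w ≤ a * (1 + 1 / 50) ∨ a * (63 / 50) ≤ dist y w)) ∧ (∃ T : Finset (EuclideanSpace ℝ (Fin 3)), (↑T : Set (EuclideanSpace ℝ (Fin 3))) = (fun w => a⁻¹ • (w - y)) '' {w ∈ Y | w ≠ y ∧ dist y w ≤ a * (1 + 1 / 50)} ∧ (Literature.Geometry.DiscreteGeometry.ShellCloseTo (1 / 5) T Literature.Geometry.DiscreteGeometry.fccKissingPattern ∨ Literature.Geometry.DiscreteGeometry.ShellCloseTo (1 / 5) T Literature.Geometry.DiscreteGeometry.hcpKissingPattern)) ∧ dist z y ≤ 10)) → (∃ a : ℝ, 47 / 50 ≤ a ∧ a ≤ 1 ∧ ∃ t : ℝ, 0 < t ∧ ∃ y ∈ Y, ({w ∈ Y | w ≠ y ∧ dist y w ≤ a * (1 + 1 / 50) - t}.ncard = 12 ∧ (∀ w ∈ Y, w ≠ y → a * (1 - 1 / 50) + t ≤ dist y w ∧ (dist y w ≤ a * (1 + 1 / 50) - t ∨ a * (63 / 50) + t ≤ dist y w)) ∧ (∃ T : Finset (EuclideanSpace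 ℝ (Fin 3)), (↑T : Set (EuclideanSpace ℝ (Fin 3))) = (fun w => a⁻¹ • (w - y)) '' {w ∈ Y | w ≠ y ∧ dist y w ≤ a * (1 + 1 / 50)} ∧ (Literature.Geometry.DiscreteGeometry.ShellCloseTo (1 / 5 - t) T Literature.Geometry.DiscreteGeometry.fccKissingPattern ∨ Literature.Geometry.DiscreteGeometry.ShellCloseTo (1 / 5 - t) T Literature.Geometry.DiscreteGeometry.hcpKissingPattern)))) → ∃ W : Literature.MathematicalPhysics.StatisticalMechanics.PeriodicConfiguration 3, ∀ R ε : ℝ, 0 < ε → ∃ᶠ N in Filter.atTop, ∃ t : EuclideanSpace ℝ (Fin 3), (∀ s ∈ W.points, ‖s‖ ≤ R → ∃ i : Fin N, dist (x N i + t) s ≤ ε) ∧ (∀ i : Fin N, ‖x N i + t‖ ≤ R → ∃ s ∈ W.points, dist (x N i + t) s ≤ ε)) :=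
  Iff.rfl

/-- PIN · the door-side piece of generation 18 at `r₀ = 10`, fully expanded. -/
theorem deepPiece_ten_iff : DeepPiece 10 ↔ (∀ e : ℝ, Filter.Tendsto (fun N : ℕ => Literature.MathematicalPhysics.StatisticalMechanics.groundStateEnergy Literature.MathematicalPhysics.StatisticalMechanics.lennardJones 3 N / N) Filter.atTop (nhds e) → (∀ N : ℕ, 0 < N → e ≤ Literature.MathematicalPhysics.StatisticalMechanics.groundStateEnergy Literature.MathematicalPhysics.StatisticalMechanics.lennardJones 3 N / N) → ∀ x : (N : ℕ) → (Fin N → EuclideanSpace ℝ (Fin 3)), (∀ N, Literature.MathematicalPhysics.StatisticalMechanics.IsGroundState Literature.MathematicalPhysics.StatisticalMechanics.lennardJones (x N)) → ∀ Y : Set (EuclideanSpace ℝ (Fin 3)), (0 : EuclideanSpace ℝ (Fin 3)) ∈ Y → (∀ R ε : ℝ, 0 < ε → ∃ L : ℝ, ∀ p ∈ Y, ∀ q ∈ Y, ∃ q' ∈ Y, dist q' q ≤ L ∧ (∀ y ∈ Y, dist y p ≤ R → ∃ y' ∈ Y, dist (y' - q') (y - p) ≤ ε) ∧ (∀ y'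 ∈ Y, dist y' q' ≤ R → ∃ y ∈ Y, dist (y' - q') (y - p) ≤ ε)) → (∃ (φ : ℕ → ℕ) (t : ℕ → EuclideanSpace ℝ (Fin 3)), StrictMono φ ∧ ∀ R ε : ℝ, 0 < ε → ∀ᶠ n in Filter.atTop, (∀ y ∈ Y, ‖y‖ ≤ R → ∃ i : Fin (φ n), dist (x (φ n) i + t n) y ≤ ε) ∧ (∀ i : Fin (φ n), ‖x (φ n) i + t n‖ ≤ R → ∃ y ∈ Y, dist (x (φ n) i + t n) y ≤ ε)) → Literature.MathematicalPhysics.StatisticalMechanics.UniformlyDiscrete Y → Literature.MathematicalPhysics.StatisticalMechanics.IsMuGSC Literature.MathematicalPhysics.StatisticalMechanics.lennardJones e Y → (¬ (∃ a : ℝ, 47 / 50 ≤ a ∧ a ≤ 1 ∧ ∀ y ∈ Y, ({w ∈ Y | w ≠ y ∧ dist y w ≤ a * (1 + 1 / 50)}.ncard = 12 ∧ ∀ w ∈ Y, w ≠ y → a * (1 - 1 / 50) ≤ dist y w ∧ (dist y w ≤ a * (1 + 1 / 50) ∨ a * (63 / 50) ≤ dist y w)))) → (∀ z : EuclideanSpace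 ℝ (Fin 3), ∃ w ∈ Y, dist z w < 9 / 10) → (¬ (∃ W : Literature.MathematicalPhysics.StatisticalMechanics.PeriodicConfiguration 3, W.points = Y)) → (∃ ℓ₀ : ℝ, ∀ ℓ : ℝ, ∀ c : EuclideanSpace ℝ (Fin 3), ℓ₀ ≤ ℓ → ((Y ∩ {z | ∀ i : Fin 3, c i ≤ z i ∧ z i < c i + ℓ}).ncard : ℝ) < 2 * ℓ ^ 3) → (∃ ℓ₀ : ℝ, ∀ ℓ : ℝ, ∀ c : EuclideanSpace ℝ (Fin 3), ℓ₀ ≤ ℓ → 5 / 4 * ℓ ^ 3 < ((Y ∩ {z | ∀ i : Fin 3, c i ≤ z i ∧ z i < c i + ℓ}).ncard : ℝ)) → (¬ (∃ a : ℝ, 47 / 50 ≤ a ∧ a ≤ 1 ∧ ∃ K : ℝ, 0 < K ∧ ∃ c : EuclideanSpace ℝ (Fin 3), (∃ y ∈ Y, dist y c ≤ K ∧ ¬ (({v ∈ Y | v ≠ y ∧ dist y v ≤ a * (1 + 1 / 10)}.ncard = 12 ∧ ∀ v ∈ Y, v ≠ y → a * (1 - 1 / 10) ≤ dist y v ∧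 (dist y v ≤ a * (1 + 1 / 10) ∨ a * (63 / 50) ≤ dist y v)) ∧ (∃ T : Finset (EuclideanSpace ℝ (Fin 3)), (↑T : Set (EuclideanSpace ℝ (Fin 3))) = (fun v => a⁻¹ • (v - y)) '' {v ∈ Y | v ≠ y ∧ dist y v ≤ a * (1 + 1 / 10)} ∧ (Literature.Geometry.DiscreteGeometry.ShellCloseTo (2 / 5) T Literature.Geometry.DiscreteGeometry.fccKissingPattern ∨ Literature.Geometry.DiscreteGeometry.ShellCloseTo (2 / 5) T Literature.Geometry.DiscreteGeometry.hcpKissingPattern)))) ∧ (∀ w ∈ Y, K < dist w c → dist w c ≤ 4 * K + 6 → (({v ∈ Y | v ≠ w ∧ dist w v ≤ a * (1 + 1 / 50)}.ncard = 12 ∧ ∀ v ∈ Y, v ≠ w → a * (1 - 1 / 50) ≤ dist w v ∧ (dist w v ≤ a * (1 + 1 / 50) ∨ a * (63 / 50) ≤ dist w v)) ∧ (∃ T : Finset (EuclideanSpace ℝ (Fin 3)), (↑T : Set (EuclideanSpace ℝ (Fin 3))) = (fun v => a⁻¹ • (v - w)) '' {v ∈ Y | v ≠ w ∧ dist w v ≤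 a * (1 + 1 / 50)} ∧ (Literature.Geometry.DiscreteGeometry.ShellCloseTo (1 / 5) T Literature.Geometry.DiscreteGeometry.fccKissingPattern ∨ Literature.Geometry.DiscreteGeometry.ShellCloseTo (1 / 5) T Literature.Geometry.DiscreteGeometry.hcpKissingPattern)))))) → ((∃ y ∈ Y, (∑' w : ↥Y, Literature.MathematicalPhysics.StatisticalMechanics.lennardJones (dist y (w : EuclideanSpace ℝ (Fin 3)))) < 2 * e) ∧ (∃ y ∈ Y, 2 * e < (∑' w : ↥Y, Literature.MathematicalPhysics.StatisticalMechanics.lennardJones (dist y (w : EuclideanSpace ℝ (Fin 3)))))) → (¬ (∃ κ : ℝ, 0 < κ ∧ (∀ ℓ₀ : ℝ, ∃ ℓ : ℝ, ℓ₀ ≤ ℓ ∧ ∃ c : EuclideanSpace ℝ (Fin 3), ∃ F : Finset (EuclideanSpace ℝ (Fin 3)), (↑F : Set (EuclideanSpace ℝ (Fin 3))) = Y ∩ {z | ∀ i : Fin 3, c i ≤ z i ∧ z i < c i + ℓ} ∧ ∃ H : Finset (EuclideanSpace ℝ (Fin 3)), H ⊆ F ∧ 1 / 8 * ((F.card : ℝ)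 - (H.card : ℝ)) + κ * (F.card : ℝ) ≤ ∑ y ∈ H, ((∑' w : ↥Y, Literature.MathematicalPhysics.StatisticalMechanics.lennardJones (dist y (w : EuclideanSpace ℝ (Fin 3)))) - 2 * e)))) → (∃ L t : ℝ, 0 < t ∧ ∀ q ∈ Y, ∀ a : ℝ, 47 / 50 ≤ a → a ≤ 1 → ∃ y ∈ Y, dist y q ≤ L ∧ ¬ ({w ∈ Y | w ≠ y ∧ dist y w < a * (63 / 50) - t}.ncard ≤ 12 ∧ 12 ≤ {w ∈ Y | w ≠ y ∧ dist y w ≤ a * (1 + 1 / 50) + t}.ncard ∧ ∀ w ∈ Y, w ≠ y → a * (1 - 1 / 50) - t ≤ dist y w ∧ (dist y w ≤ a * (1 + 1 / 50) + t ∨ a * (63 / 50) - t ≤ dist y w))) → ¬ (∃ a : ℝ, 47 / 50 ≤ a ∧ a ≤ 1 ∧ (∀ y ∈ Y, ({w ∈ Y | w ≠ y ∧ dist y w ≤ a * (1 + 1 / 50)}.ncard = 12 ∧ ∀ w ∈ Y, w ≠ y → a * (1 - 1 / 50) ≤ dist y w ∧ (dist y w ≤ a * (1 + 1 / 50) ∨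 a * (63 / 50) ≤ dist y w)) → (∃ T : Finset (EuclideanSpace ℝ (Fin 3)), (↑T : Set (EuclideanSpace ℝ (Fin 3))) = (fun w => a⁻¹ • (w - y)) '' {w ∈ Y | w ≠ y ∧ dist y w ≤ a * (1 + 1 / 50)} ∧ (Literature.Geometry.DiscreteGeometry.ShellCloseTo (1 / 5) T Literature.Geometry.DiscreteGeometry.fccKissingPattern ∨ Literature.Geometry.DiscreteGeometry.ShellCloseTo (1 / 5) T Literature.Geometry.DiscreteGeometry.hcpKissingPattern))) ∧ (∀ z : EuclideanSpace ℝ (Fin 3), ∃ y ∈ Y, ({w ∈ Y | w ≠ y ∧ dist y w ≤ a * (1 + 1 / 50)}.ncard = 12 ∧ ∀ w ∈ Y, w ≠ y → a * (1 - 1 / 50) ≤ dist y w ∧ (dist y w ≤ a * (1 + 1 / 50) ∨ a * (63 / 50) ≤ dist y w)) ∧ (∃ T : Finset (EuclideanSpace ℝ (Fin 3)), (↑T : Set (EuclideanSpace ℝ (Fin 3))) = (fun w => a⁻¹ • (w - y)) '' {w ∈ Y | w ≠ y ∧ dist y w ≤ a * (1 + 1 / 50)} ∧ (Literature.Geometry.DiscreteGeometry.ShellCloseTo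 (1 / 5) T Literature.Geometry.DiscreteGeometry.fccKissingPattern ∨ Literature.Geometry.DiscreteGeometry.ShellCloseTo (1 / 5) T Literature.Geometry.DiscreteGeometry.hcpKissingPattern)) ∧ dist z y ≤ 10)) → (∃ a : ℝ, 47 / 50 ≤ a ∧ a ≤ 1 ∧ ∃ t : ℝ, 0 < t ∧ ∃ y ∈ Y, ({w ∈ Y | w ≠ y ∧ dist y w ≤ a * (1 + 1 / 50) - t}.ncard = 12 ∧ (∀ w ∈ Y, w ≠ y → a * (1 - 1 / 50) + t ≤ dist y w ∧ (dist y w ≤ a * (1 + 1 / 50) - t ∨ a * (63 / 50) + t ≤ dist y w)) ∧ (∃ T : Finset (EuclideanSpace ℝ (Fin 3)), (↑T : Set (EuclideanSpace ℝ (Fin 3))) = (fun w => a⁻¹ • (w - y)) '' {w ∈ Y | w ≠ y ∧ dist y w ≤ a * (1 + 1 / 50)} ∧ (Literature.Geometry.DiscreteGeometry.ShellCloseTo (1 / 5 - t) T Literature.Geometry.DiscreteGeometry.fccKissingPattern ∨ Literature.Geometry.DiscreteGeometry.ShellCloseTo (1 / 5 - t) T Literature.Geometry.DiscreteGeometry.hcpKissingPattern))))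 → ¬ (∀ t : ℝ, 0 < t → t < 1 / 200 → ∃ R : ℝ, ∀ c : EuclideanSpace ℝ (Fin 3), ∃ y ∈ Y, dist y c ≤ R ∧ ∃ a : ℝ, 47 / 50 ≤ a ∧ a ≤ 1 ∧ ({w ∈ Y | w ≠ y ∧ dist y w ≤ a * (1 + 1 / 50) - t}.ncard = 12 ∧ (∀ w ∈ Y, w ≠ y → a * (1 - 1 / 50) + t ≤ dist y w ∧ (dist y w ≤ a * (1 + 1 / 50) - t ∨ a * (63 / 50) + t ≤ dist y w)) ∧ (∃ T : Finset (EuclideanSpace ℝ (Fin 3)), (↑T : Set (EuclideanSpace ℝ (Fin 3))) = (fun w => a⁻¹ • (w - y)) '' {w ∈ Y | w ≠ y ∧ dist y w ≤ a * (1 + 1 / 50)} ∧ (Literature.Geometry.DiscreteGeometry.ShellCloseTo (1 / 5 - t) T Literature.Geometry.DiscreteGeometry.fccKissingPattern ∨ Literature.Geometry.DiscreteGeometry.ShellCloseTo (1 / 5 - t) T Literature.Geometry.DiscreteGeometry.hcpKissingPattern)))) → ∃ W : Literature.MathematicalPhysics.StatisticalMechanics.PeriodicConfiguration 3, ∀ R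 ε : ℝ, 0 < ε → ∃ᶠ N in Filter.atTop, ∃ t : EuclideanSpace ℝ (Fin 3), (∀ s ∈ W.points, ‖s‖ ≤ R → ∃ i : Fin N, dist (x N i + t) s ≤ ε) ∧ (∀ i : Fin N, ‖x N i + t‖ ≤ R → ∃ s ∈ W.points, dist (x N i + t) s ≤ ε)) :=
  Iff.rfl

/-- PIN · THE DECLARED RESIDUAL of generation 18 at `r₀ = 10`, fully expanded (the text a later bundle registers as `stub_shallowResidual`). -/
theorem shallowResidual_ten_iff : ShallowResidual 10 ↔ (∀ e : ℝ, Filter.Tendsto (fun N : ℕ => Literature.MathematicalPhysics.StatisticalMechanics.groundStateEnergy Literature.MathematicalPhysics.StatisticalMechanics.lennardJones 3 N / N) Filter.atTop (nhds e) → (∀ N : ℕ, 0 < N → e ≤ Literature.MathematicalPhysics.StatisticalMechanics.groundStateEnergy Literature.MathematicalPhysics.StatisticalMechanics.lennardJones 3 N / N) → ∀ x : (N : ℕ) → (Fin N → EuclideanSpace ℝ (Fin 3)), (∀ N, Literature.MathematicalPhysics.StatisticalMechanics.IsGroundState Literature.MathematicalPhysics.StatisticalMechanics.lennardJones (x N))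 → ∀ Y : Set (EuclideanSpace ℝ (Fin 3)), (0 : EuclideanSpace ℝ (Fin 3)) ∈ Y → (∀ R ε : ℝ, 0 < ε → ∃ L : ℝ, ∀ p ∈ Y, ∀ q ∈ Y, ∃ q' ∈ Y, dist q' q ≤ L ∧ (∀ y ∈ Y, dist y p ≤ R → ∃ y' ∈ Y, dist (y' - q') (y - p) ≤ ε) ∧ (∀ y' ∈ Y, dist y' q' ≤ R → ∃ y ∈ Y, dist (y' - q') (y - p) ≤ ε)) → (∃ (φ : ℕ → ℕ) (t : ℕ → EuclideanSpace ℝ (Fin 3)), StrictMono φ ∧ ∀ R ε : ℝ, 0 < ε → ∀ᶠ n in Filter.atTop, (∀ y ∈ Y, ‖y‖ ≤ R → ∃ i : Fin (φ n), dist (x (φ n) i + t n) y ≤ ε) ∧ (∀ i : Fin (φ n), ‖x (φ n) i + t n‖ ≤ R → ∃ y ∈ Y, dist (x (φ n) i + t n) y ≤ ε)) → Literature.MathematicalPhysics.StatisticalMechanics.UniformlyDiscrete Y → Literature.MathematicalPhysics.StatisticalMechanics.IsMuGSC Literature.MathematicalPhysics.StatisticalMechanics.lennardJones e Y → (¬ (∃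 a : ℝ, 47 / 50 ≤ a ∧ a ≤ 1 ∧ ∀ y ∈ Y, ({w ∈ Y | w ≠ y ∧ dist y w ≤ a * (1 + 1 / 50)}.ncard = 12 ∧ ∀ w ∈ Y, w ≠ y → a * (1 - 1 / 50) ≤ dist y w ∧ (dist y w ≤ a * (1 + 1 / 50) ∨ a * (63 / 50) ≤ dist y w)))) → (∀ z : EuclideanSpace ℝ (Fin 3), ∃ w ∈ Y, dist z w < 9 / 10) → (¬ (∃ W : Literature.MathematicalPhysics.StatisticalMechanics.PeriodicConfiguration 3, W.points = Y)) → (∃ ℓ₀ : ℝ, ∀ ℓ : ℝ, ∀ c : EuclideanSpace ℝ (Fin 3), ℓ₀ ≤ ℓ → ((Y ∩ {z | ∀ i : Fin 3, c i ≤ z i ∧ z i < c i + ℓ}).ncard : ℝ) < 2 * ℓ ^ 3) → (∃ ℓ₀ : ℝ, ∀ ℓ : ℝ, ∀ c : EuclideanSpace ℝ (Fin 3), ℓ₀ ≤ ℓ → 5 / 4 * ℓ ^ 3 < ((Y ∩ {z | ∀ i : Fin 3, c i ≤ z i ∧ z i < c i + ℓ}).ncard : ℝ)) → (¬ (∃ a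 : ℝ, 47 / 50 ≤ a ∧ a ≤ 1 ∧ ∃ K : ℝ, 0 < K ∧ ∃ c : EuclideanSpace ℝ (Fin 3), (∃ y ∈ Y, dist y c ≤ K ∧ ¬ (({v ∈ Y | v ≠ y ∧ dist y v ≤ a * (1 + 1 / 10)}.ncard = 12 ∧ ∀ v ∈ Y, v ≠ y → a * (1 - 1 / 10) ≤ dist y v ∧ (dist y v ≤ a * (1 + 1 / 10) ∨ a * (63 / 50) ≤ dist y v)) ∧ (∃ T : Finset (EuclideanSpace ℝ (Fin 3)), (↑T : Set (EuclideanSpace ℝ (Fin 3))) = (fun v => a⁻¹ • (v - y)) '' {v ∈ Y | v ≠ y ∧ dist y v ≤ a * (1 + 1 / 10)} ∧ (Literature.Geometry.DiscreteGeometry.ShellCloseTo (2 / 5) T Literature.Geometry.DiscreteGeometry.fccKissingPattern ∨ Literature.Geometry.DiscreteGeometry.ShellCloseTo (2 / 5) T Literature.Geometry.DiscreteGeometry.hcpKissingPattern)))) ∧ (∀ w ∈ Y, K < dist w c → dist w c ≤ 4 * K + 6 → (({v ∈ Y | v ≠ w ∧ dist w v ≤ a * (1 + 1 / 50)}.ncard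 = 12 ∧ ∀ v ∈ Y, v ≠ w → a * (1 - 1 / 50) ≤ dist w v ∧ (dist w v ≤ a * (1 + 1 / 50) ∨ a * (63 / 50) ≤ dist w v)) ∧ (∃ T : Finset (EuclideanSpace ℝ (Fin 3)), (↑T : Set (EuclideanSpace ℝ (Fin 3))) = (fun v => a⁻¹ • (v - w)) '' {v ∈ Y | v ≠ w ∧ dist w v ≤ a * (1 + 1 / 50)} ∧ (Literature.Geometry.DiscreteGeometry.ShellCloseTo (1 / 5) T Literature.Geometry.DiscreteGeometry.fccKissingPattern ∨ Literature.Geometry.DiscreteGeometry.ShellCloseTo (1 / 5) T Literature.Geometry.DiscreteGeometry.hcpKissingPattern)))))) → ((∃ y ∈ Y, (∑' w : ↥Y, Literature.MathematicalPhysics.StatisticalMechanics.lennardJones (dist y (w : EuclideanSpace ℝ (Fin 3)))) < 2 * e) ∧ (∃ y ∈ Y, 2 * e < (∑' w : ↥Y, Literature.MathematicalPhysics.StatisticalMechanics.lennardJones (dist y (w : EuclideanSpace ℝ (Fin 3)))))) → (¬ (∃ κ : ℝ, 0 < κ ∧ (∀ ℓ₀ : ℝ, ∃ ℓ : ℝ,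 ℓ₀ ≤ ℓ ∧ ∃ c : EuclideanSpace ℝ (Fin 3), ∃ F : Finset (EuclideanSpace ℝ (Fin 3)), (↑F : Set (EuclideanSpace ℝ (Fin 3))) = Y ∩ {z | ∀ i : Fin 3, c i ≤ z i ∧ z i < c i + ℓ} ∧ ∃ H : Finset (EuclideanSpace ℝ (Fin 3)), H ⊆ F ∧ 1 / 8 * ((F.card : ℝ) - (H.card : ℝ)) + κ * (F.card : ℝ) ≤ ∑ y ∈ H, ((∑' w : ↥Y, Literature.MathematicalPhysics.StatisticalMechanics.lennardJones (dist y (w : EuclideanSpace ℝ (Fin 3)))) - 2 * e)))) → (∃ L t : ℝ, 0 < t ∧ ∀ q ∈ Y, ∀ a : ℝ, 47 / 50 ≤ a → a ≤ 1 → ∃ y ∈ Y, dist y q ≤ L ∧ ¬ ({w ∈ Y | w ≠ y ∧ dist y w < a * (63 / 50) - t}.ncard ≤ 12 ∧ 12 ≤ {w ∈ Y | w ≠ y ∧ dist y w ≤ a * (1 + 1 / 50) + t}.ncard ∧ ∀ w ∈ Y, w ≠ y → a * (1 - 1 / 50) - t ≤ dist y w ∧ (dist y w ≤ a * (1 + 1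 / 50) + t ∨ a * (63 / 50) - t ≤ dist y w))) → ¬ (∃ a : ℝ, 47 / 50 ≤ a ∧ a ≤ 1 ∧ (∀ y ∈ Y, ({w ∈ Y | w ≠ y ∧ dist y w ≤ a * (1 + 1 / 50)}.ncard = 12 ∧ ∀ w ∈ Y, w ≠ y → a * (1 - 1 / 50) ≤ dist y w ∧ (dist y w ≤ a * (1 + 1 / 50) ∨ a * (63 / 50) ≤ dist y w)) → (∃ T : Finset (EuclideanSpace ℝ (Fin 3)), (↑T : Set (EuclideanSpace ℝ (Fin 3))) = (fun w => a⁻¹ • (w - y)) '' {w ∈ Y | w ≠ y ∧ dist y w ≤ a * (1 + 1 / 50)} ∧ (Literature.Geometry.DiscreteGeometry.ShellCloseTo (1 / 5) T Literature.Geometry.DiscreteGeometry.fccKissingPattern ∨ Literature.Geometry.DiscreteGeometry.ShellCloseTo (1 / 5) T Literature.Geometry.DiscreteGeometry.hcpKissingPattern))) ∧ (∀ z : EuclideanSpace ℝ (Fin 3), ∃ y ∈ Y, ({w ∈ Y | w ≠ y ∧ dist y w ≤ a * (1 + 1 / 50)}.ncard = 12 ∧ ∀ w ∈ Y, w ≠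 y → a * (1 - 1 / 50) ≤ dist y w ∧ (dist y w ≤ a * (1 + 1 / 50) ∨ a * (63 / 50) ≤ dist y w)) ∧ (∃ T : Finset (EuclideanSpace ℝ (Fin 3)), (↑T : Set (EuclideanSpace ℝ (Fin 3))) = (fun w => a⁻¹ • (w - y)) '' {w ∈ Y | w ≠ y ∧ dist y w ≤ a * (1 + 1 / 50)} ∧ (Literature.Geometry.DiscreteGeometry.ShellCloseTo (1 / 5) T Literature.Geometry.DiscreteGeometry.fccKissingPattern ∨ Literature.Geometry.DiscreteGeometry.ShellCloseTo (1 / 5) T Literature.Geometry.DiscreteGeometry.hcpKissingPattern)) ∧ dist z y ≤ 10)) → (∃ a : ℝ, 47 / 50 ≤ a ∧ a ≤ 1 ∧ ∃ t : ℝ, 0 < t ∧ ∃ y ∈ Y, ({w ∈ Y | w ≠ y ∧ dist y w ≤ a * (1 + 1 / 50) - t}.ncard = 12 ∧ (∀ w ∈ Y, w ≠ y → a * (1 - 1 / 50) + t ≤ dist y w ∧ (dist y w ≤ a * (1 + 1 / 50) - t ∨ a * (63 / 50) + t ≤ dist y w)) ∧ (∃ T : Finset (EuclideanSpace ℝ (Fin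 3)), (↑T : Set (EuclideanSpace ℝ (Fin 3))) = (fun w => a⁻¹ • (w - y)) '' {w ∈ Y | w ≠ y ∧ dist y w ≤ a * (1 + 1 / 50)} ∧ (Literature.Geometry.DiscreteGeometry.ShellCloseTo (1 / 5 - t) T Literature.Geometry.DiscreteGeometry.fccKissingPattern ∨ Literature.Geometry.DiscreteGeometry.ShellCloseTo (1 / 5 - t) T Literature.Geometry.DiscreteGeometry.hcpKissingPattern)))) → (∀ t : ℝ, 0 < t → t < 1 / 200 → ∃ R : ℝ, ∀ c : EuclideanSpace ℝ (Fin 3), ∃ y ∈ Y, dist y c ≤ R ∧ ∃ a : ℝ, 47 / 50 ≤ a ∧ a ≤ 1 ∧ ({w ∈ Y | w ≠ y ∧ dist y w ≤ a * (1 + 1 / 50) - t}.ncard = 12 ∧ (∀ w ∈ Y, w ≠ y → a * (1 - 1 / 50) + t ≤ dist y w ∧ (dist y w ≤ a * (1 + 1 / 50) - t ∨ a * (63 / 50) + t ≤ dist y w)) ∧ (∃ T : Finset (EuclideanSpace ℝ (Fin 3)), (↑T : Set (EuclideanSpace ℝ (Fin 3))) = (fun w => a⁻¹ • (w - y)) ''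 {w ∈ Y | w ≠ y ∧ dist y w ≤ a * (1 + 1 / 50)} ∧ (Literature.Geometry.DiscreteGeometry.ShellCloseTo (1 / 5 - t) T Literature.Geometry.DiscreteGeometry.fccKissingPattern ∨ Literature.Geometry.DiscreteGeometry.ShellCloseTo (1 / 5 - t) T Literature.Geometry.DiscreteGeometry.hcpKissingPattern)))) → ∃ W : Literature.MathematicalPhysics.StatisticalMechanics.PeriodicConfiguration 3, ∀ R ε : ℝ, 0 < ε → ∃ᶠ N in Filter.atTop, ∃ t : EuclideanSpace ℝ (Fin 3), (∀ s ∈ W.points, ‖s‖ ≤ R → ∃ i : Fin N, dist (x N i + t) s ≤ ε) ∧ (∀ i : Fin N, ‖x N i + t‖ ≤ R → ∃ s ∈ W.points, dist (x N i + t) s ≤ ε)) :=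
  Iff.rfl

end Summit.AtomisticToContinuum.Crystallization.Theorems.OverbindingBudgetCleanlessCutDepth
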